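import Summits.SmoothPoincare4.SmoothPoincare4.Theses.CongruenceShadows
import Summits.SmoothPoincare4.SmoothPoincare4.Theorems.NormalFormStablyTrivial.Negative.ZKernelsNormalForm
import Summits.SmoothPoincare4.SmoothPoincare4.Theorems.AgkCor6Sufficiency.Negative.StablyTrivialTight
import Summits.SmoothPoincare4.SmoothPoincare4.Theorems.WaldhausenPairs.Negative.PairTransferFalse
import Summits.SmoothPoincare4.SmoothPoincare4.Theorems.WaldhausenPairs.Negative.LoadBearing
import Literature.Topology.FourManifolds.TrisectionFunctorSPC4Proofs
import Summits.SmoothPoincare4.SmoothPoincare4.Theorems.AgkCor6Sufficiency.Negative.DownwardClosed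

/-!
# `NormalFormStablyTrivial` — negative-side support I: `π₁ = 1` is load-bearing; the other
# trisection fields are decoration; the gate form

Refuter support file (cdisprove seat) for crux item stmt-SmoothPoincare4-14591
(`CongruenceShadows.NormalFormStablyTrivial`, the route's target):

  ∀ m K, IsGroupTrisection (3+3m) (m+1) PUnit K → PairsStandard m K → K.IsStablyTrivial,
  PairsStandard m K := ∀ i ≠ j, ∃ α ∈ Aut S_{3+3m}, α(N i) = K i ∧ α(N j) = K j,
  N := s4Kernels.stabilizeIter m.

Everything here is PROVED (no `sorry`, no named facts, no closed `Prop` definitions; the only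
definitions are the parametrised predicates `PairsStandard`, `InGate` and three explicit
automorphisms of `S_3`).  Nothing concludes the crux or any Theses statement.

* §1 `normalFormStablyTrivial_iff` (read-back, `Iff.rfl`); `standard_model`: at every `m` the
  standard triple satisfies both hypotheses (`α = 1`) and the conclusion (`n = 0`).
* §2 Under `PairsStandard` the fields `normal`, `free_quotient`, `free_pairQuotient` of
  `IsGroupTrisection` are implied (`isGroupTrisection_of_pairsStandard`: a normal form is a
  `(3+3m, m+1)` group trisection of its own triple quotient); hence
  `normalFormStablyTrivial_iff_tripleForm`: crux ⇔ `∀ m K, π₁ = 1 → PairsStandard m K →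
  stably trivial`; and `not_isStablyTrivial_of_pairsStandard_of_nontrivial` (`π₁` obstructs).
* §3 **`π₁ = 1` is load-bearing**: `normalFormStablyTrivial_false_without_triple` — the any-group
  version is FALSE, witnessed at `m = 0` by the `(3;1,1,1)` trisection `zKernels` of
  `S¹×S³ # ℂP² # ℂP²` (`AgkCor6Sufficiency/Negative/AnyGroupFalse.lean`), which is in Waldhausen
  normal form (`pairs_zKernels`, sibling file `ZKernelsNormalForm.lean`: three explicit relator-fixing
  automorphisms of `S_3` composed with the slot symmetries of the standard triple) but not stably
  trivial (`π₁ = ℤ`).  `normalFormStablyTrivial_false_without_hyp`: dropping the whole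
  `IsGroupTrisection` hypothesis is fatal by the same witness.
* §4 Gate form: `InGate m K` (`K₀ = N₀`, `K₁ = N₁`, `π₁ = 1`, `K₂ ∈ Stab(N₀)·N₂ ∩ Stab(N₁)·N₂`);
  `isStablyTrivial_of_inGate` (crux ⇒ gate form) and `normalFormStablyTrivial_iff_gate`: modulo
  `Iso`-invariance of `IsStablyTrivial` (Nielsen 1927, in tree only for liftable automorphisms)
  the crux IS its gate form — "WLOG `(K₀,K₁) = (N₀,N₁)`" costs exactly Nielsen;
  `isoInvariant_of_nielsen` / `normalFormStablyTrivial_iff_gate_of_nielsen` tie this to the tree's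
  registered Nielsen hypothesis `hN` (shape of `TrisectionKernels.Iso.stabilizeIter_of_liftable`).

* §5 `level_down_of_nielsen`: granted Nielsen the crux at level `m+1` implies it at level `m`
  (hypotheses ascend along one stabilisation, stable triviality descends), so it may be assumed only
  for `m ≥ m₀`.

References: A. Abrams, D. Gay, R. Kirby, *Group trisections and smooth 4-manifolds*, Geom. Topol.
22 (2018) 1537–1545, Def. 1–3, Thm. 5, Cor. 6; D. Gay, R. Kirby, *Trisecting 4-manifolds*, Geom.
Topol. 20 (2016), §2; F. Waldhausen, Topology 7 (1968); J. Nielsen, Acta Math. 50 (1927).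
-/

-- the prescribed namespace `Summit.<P>.<Sub>.…` duplicates `SmoothPoincare4` (P = Sub)
set_option linter.dupNamespace false

noncomputable section

namespace Summit.SmoothPoincare4.SmoothPoincare4.Theorems.NormalFormStablyTrivial.Negative

open Literature.Topology.FourManifolds Subgroup
open Summit.SmoothPoincare4.SmoothPoincare4.Theses.CongruenceShadows (NormalFormStablyTrivial WaldhausenPairs)
open Summit.SmoothPoincare4.SmoothPoincare4.Theorems.AgkCor6Sufficiency.Negative
  (zKernels zKernels_isGroupTrisection not_isStablyTrivial_zKernels
   not_subsingleton_tripleQuotient_zKernels isStablyTrivial_tight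
   isStablyTrivial_s4Kernels_stabilizeIter Iso.nonempty_tripleQuotient_equiv
   isStablyTrivial_of_stabilizeIter)
open Summit.SmoothPoincare4.SmoothPoincare4.Theorems.WaldhausenPairs.Negative
  (stabilizeIter_isGroupTrisection IsGroupTrisection.map_mulEquiv)

variable {m : ℕ}

/-! ## §1 Read-back, the standard model, non-vacuity -/

/-- The normal-form hypothesis of the crux: every ordered pair of kernels is the image of the
corresponding standard pair under ONE automorphism of `S_{3+3m}`. [folklore] -/
def PairsStandard (m : ℕ) (K : TrisectionKernels (3 + 3 * m)) : Prop :=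
  ∀ i j : Fin 3, i ≠ j → ∃ α : SurfaceGroup (3 + 3 * m) ≃* SurfaceGroup (3 + 3 * m),
    (s4Kernels.stabilizeIter m i).map α.toMonoidHom = K i ∧
    (s4Kernels.stabilizeIter m j).map α.toMonoidHom = K j

/-- READ-BACK: the crux is literally `∀ m K, IsGroupTrisection (3+3m) (m+1) 1 K →
PairsStandard m K → K.IsStablyTrivial`. [folklore] -/
theorem normalFormStablyTrivial_iff :
    NormalFormStablyTrivial ↔ ∀ (m : ℕ) (K : TrisectionKernels (3 + 3 * m)),
      IsGroupTrisection (3 + 3 * m) (m + 1) (PUnit : Type) K → PairsStandard m K →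
        K.IsStablyTrivial :=
  Iff.rfl

/-- The standard triple is in normal form (`α = 1`). [folklore] -/
theorem pairsStandard_std (m : ℕ) : PairsStandard m (s4Kernels.stabilizeIter m) :=
  fun _ _ _ => ⟨MulEquiv.refl _, by simp, by simp⟩

/-- NON-VACUITY / TIGHTNESS AT THE STANDARD MODEL: at every `m` the standard triple satisfies both
hypotheses and the conclusion (with `n = 0` stabilisations). [folklore] -/
theorem standard_model (m : ℕ) :
    IsGroupTrisection (3 + 3 * m) (m + 1) (PUnit : Type) (s4Kernels.stabilizeIter m) ∧
      PairsStandard m (s4Kernels.stabilizeIter m) ∧ (s4Kernels.stabilizeIter m).IsStablyTrivial :=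
  ⟨stabilizeIter_isGroupTrisection m, pairsStandard_std m, isStablyTrivial_s4Kernels_stabilizeIter m⟩

/-! ## §2 Which hypotheses carry weight: `normal`, `free_quotient`, `free_pairQuotient` are
DECORATION under `PairsStandard`; only `triple` (π₁ = 1) is independent -/

/-- Each slot of a normal form is individually standard. [folklore] -/
theorem exists_slot_of_pairsStandard {K : TrisectionKernels (3 + 3 * m)} (h : PairsStandard m K)
    (i : Fin 3) : ∃ α : SurfaceGroup (3 + 3 * m) ≃* SurfaceGroup (3 + 3 * m),
      (s4Kernels.stabilizeIter m i).map α.toMonoidHom = K i := by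
  obtain ⟨j, hj⟩ : ∃ j : Fin 3, i ≠ j := by
    fin_cases i
    · exact ⟨1, by decide⟩
    · exact ⟨0, by decide⟩
    · exact ⟨0, by decide⟩
  obtain ⟨α, hi, -⟩ := h i j hj
  exact ⟨α, hi⟩

/-- `normal` is implied by the normal form. [folklore] -/
theorem normal_of_pairsStandard {K : TrisectionKernels (3 + 3 * m)} (h : PairsStandard m K)
    (i : Fin 3) : (K i).Normal := by
  obtain ⟨α, hα⟩ := exists_slot_of_pairsStandard h i
  rw [← hα]
  exact ((stabilizeIter_isGroupTrisection m).normal i).map _ α.surjective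

/-- `free_quotient` (`S/Kᵢ ≅ F_{3+3m}`) is implied by the normal form. [folklore] -/
theorem free_quotient_of_pairsStandard {K : TrisectionKernels (3 + 3 * m)} (h : PairsStandard m K)
    (i : Fin 3) :
    IsFreeOfRank (SurfaceGroup (3 + 3 * m) ⧸ normalClosure (K i : Set (SurfaceGroup (3 + 3 * m))))
      (3 + 3 * m) := by
  obtain ⟨α, hα⟩ := exists_slot_of_pairsStandard h i
  have key := (IsGroupTrisection.map_mulEquiv (stabilizeIter_isGroupTrisection m) α).free_quotient i
  rwa [hα] at key

/-- `free_pairQuotient` (`S/⟪Kᵢ ∪ Kⱼ⟫ ≅ F_{m+1}`) is implied by the normal form. [folklore] -/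
theorem free_pairQuotient_of_pairsStandard {K : TrisectionKernels (3 + 3 * m)}
    (h : PairsStandard m K) (i j : Fin 3) (hij : i ≠ j) :
    IsFreeOfRank (K.pairQuotient i j) (m + 1) := by
  obtain ⟨α, hi, hj⟩ := h i j hij
  have key := (IsGroupTrisection.map_mulEquiv (stabilizeIter_isGroupTrisection m) α).free_pairQuotient i j hij
  dsimp only [TrisectionKernels.pairQuotient] at key ⊢
  rwa [hi, hj] at key

/-- A normal form is a `(3+3m, m+1)` group trisection OF ITS OWN TRIPLE QUOTIENT (and of any
group isomorphic to it): the three structural fields come for free. [folklore] -/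
theorem isGroupTrisection_of_pairsStandard {K : TrisectionKernels (3 + 3 * m)}
    (h : PairsStandard m K) {G : Type*} [Group G] (e : Nonempty (K.tripleQuotient ≃* G)) :
    IsGroupTrisection (3 + 3 * m) (m + 1) G K :=
  ⟨normal_of_pairsStandard h, free_quotient_of_pairsStandard h,
    free_pairQuotient_of_pairsStandard h, e⟩

/-- **The crux is equivalent to its triple form**: `IsGroupTrisection (3+3m) (m+1) 1 K` may be
replaced by `π₁ = 1` (the triple quotient is trivial); `normal`, `free_quotient`,
`free_pairQuotient` are consequences of `PairsStandard`. Information for the prover: those three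
fields cannot be where a proof draws strength. [folklore] -/
theorem normalFormStablyTrivial_iff_tripleForm :
    NormalFormStablyTrivial ↔ ∀ (m : ℕ) (K : TrisectionKernels (3 + 3 * m)),
      Subsingleton K.tripleQuotient → PairsStandard m K → K.IsStablyTrivial := by
  constructor
  · intro h m K hs hP
    letI : Unique K.tripleQuotient := @uniqueOfSubsingleton _ hs 1
    exact h m K (isGroupTrisection_of_pairsStandard hP ⟨MulEquiv.ofUnique⟩) hP
  · intro h m K hK hP
    obtain ⟨e⟩ := hK.triple
    exact h m K e.toEquiv.subsingleton hP

/-- Within normal forms, `π₁` obstructs stable triviality: a normal form with non-trivial triple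
quotient is never stably trivial (it is a group trisection of its triple quotient, and stable
triviality forces that group to be trivial — `isStablyTrivial_tight`). So `triple` excludes
exactly the one cheap obstruction; the crux asserts there is no other, stably. [folklore] -/
theorem not_isStablyTrivial_of_pairsStandard_of_nontrivial {K : TrisectionKernels (3 + 3 * m)}
    (h : PairsStandard m K) (hnt : Nontrivial K.tripleQuotient) : ¬ K.IsStablyTrivial := by
  intro hst
  obtain ⟨-, ⟨e⟩⟩ := isStablyTrivial_tight (isGroupTrisection_of_pairsStandard h ⟨MulEquiv.refl _⟩) hst
  exact not_subsingleton K.tripleQuotient e.toEquiv.subsingleton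
/-! ## §3 LOAD-BEARING `triple` (`π₁ = 1`) -/

/-- `PairsStandard 0 zKernels` (`N = s4Kernels.stabilizeIter 0 = s4Kernels` definitionally).
[folklore] -/
theorem pairsStandard_zKernels : PairsStandard 0 zKernels := fun i j hij => pairs_zKernels i j hij

/-- The triple quotient of `zKernels` is non-trivial (`π₁ = ℤ`, detected in `ℤ/2`). [folklore] -/
theorem nontrivial_tripleQuotient_zKernels : Nontrivial zKernels.tripleQuotient :=
  not_subsingleton_iff_nontrivial.1 not_subsingleton_tripleQuotient_zKernels

/-- **LOAD-BEARING `triple` (`π₁ = 1`).**  The any-group version of the crux is FALSE: the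
`(3;1,1,1)` trisection `zKernels` of `S¹×S³ # ℂP² # ℂP²` is a group trisection of `ℤ` in Waldhausen
normal form (`pairs_zKernels`) which is not stably trivial.  Any proof of the crux must use the
triviality of the triple quotient. [folklore] -/
theorem normalFormStablyTrivial_false_without_triple :
    ¬ ∀ (m : ℕ) (K : TrisectionKernels (3 + 3 * m)) (G : Type) [Group G],
      IsGroupTrisection (3 + 3 * m) (m + 1) G K → PairsStandard m K → K.IsStablyTrivial :=
  fun h => not_isStablyTrivial_zKernels
    (h 0 zKernels zKernels.tripleQuotient zKernels_isGroupTrisection pairsStandard_zKernels)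

/-- Same witness: dropping the whole `IsGroupTrisection` hypothesis is fatal (by §2 only `triple`
is actually lost). [folklore] -/
theorem normalFormStablyTrivial_false_without_hyp :
    ¬ ∀ (m : ℕ) (K : TrisectionKernels (3 + 3 * m)), PairsStandard m K → K.IsStablyTrivial :=
  fun h => not_isStablyTrivial_zKernels (h 0 zKernels pairsStandard_zKernels)

/-- Contrapositive usable by provers: granted the crux, a normal form that is NOT stably trivial
has `π₁ ≠ 1`. [folklore] -/
theorem nontrivial_of_not_isStablyTrivial (h : NormalFormStablyTrivial) {m : ℕ}
    {K : TrisectionKernels (3 + 3 * m)} (hP : PairsStandard m K) (hK : ¬ K.IsStablyTrivial) :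
    Nontrivial K.tripleQuotient := by
  rw [normalFormStablyTrivial_iff_tripleForm] at h
  by_contra hnt
  rw [not_nontrivial_iff_subsingleton] at hnt
  exact hK (h m K hnt hP)
/-! ## §4 The gate form (`(0,1)`-normalised triples) and the Nielsen gap -/

/-- GATE DATA for a triple: its first two kernels ARE the standard pair `(N₀, N₁)`, `π₁ = 1`, and
`K₂` lies in the gate `Stab(N₀)·N₂ ∩ Stab(N₁)·N₂`. [folklore] -/
def InGate (m : ℕ) (K : TrisectionKernels (3 + 3 * m)) : Prop :=
  K 0 = s4Kernels.stabilizeIter m 0 ∧ K 1 = s4Kernels.stabilizeIter m 1 ∧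
    Subsingleton K.tripleQuotient ∧
    (∃ β : SurfaceGroup (3 + 3 * m) ≃* SurfaceGroup (3 + 3 * m),
      (s4Kernels.stabilizeIter m 0).map β.toMonoidHom = s4Kernels.stabilizeIter m 0 ∧
      (s4Kernels.stabilizeIter m 2).map β.toMonoidHom = K 2) ∧
    (∃ γ : SurfaceGroup (3 + 3 * m) ≃* SurfaceGroup (3 + 3 * m),
      (s4Kernels.stabilizeIter m 1).map γ.toMonoidHom = s4Kernels.stabilizeIter m 1 ∧
      (s4Kernels.stabilizeIter m 2).map γ.toMonoidHom = K 2)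

/-- Gate data give a normal form. [folklore] -/
theorem pairsStandard_of_inGate {K : TrisectionKernels (3 + 3 * m)} (h : InGate m K) :
    PairsStandard m K := by
  obtain ⟨h0, h1, -, ⟨β, hb0, hb2⟩, ⟨γ, hc1, hc2⟩⟩ := h
  have p01 : ∃ α : SurfaceGroup (3 + 3 * m) ≃* SurfaceGroup (3 + 3 * m),
      (s4Kernels.stabilizeIter m 0).map α.toMonoidHom = K 0 ∧
      (s4Kernels.stabilizeIter m 1).map α.toMonoidHom = K 1 :=
    ⟨MulEquiv.refl _, by simpa using h0.symm, by simpa using h1.symm⟩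
  have p02 : ∃ α : SurfaceGroup (3 + 3 * m) ≃* SurfaceGroup (3 + 3 * m),
      (s4Kernels.stabilizeIter m 0).map α.toMonoidHom = K 0 ∧
      (s4Kernels.stabilizeIter m 2).map α.toMonoidHom = K 2 := ⟨β, hb0.trans h0.symm, hb2⟩
  have p12 : ∃ α : SurfaceGroup (3 + 3 * m) ≃* SurfaceGroup (3 + 3 * m),
      (s4Kernels.stabilizeIter m 1).map α.toMonoidHom = K 1 ∧
      (s4Kernels.stabilizeIter m 2).map α.toMonoidHom = K 2 := ⟨γ, hc1.trans h1.symm, hc2⟩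
  intro i j hij
  fin_cases i <;> fin_cases j <;>
    first
    | exact absurd rfl hij
    | exact p01
    | exact p02
    | exact p12
    | (obtain ⟨α, ha, hb⟩ := p01; exact ⟨α, hb, ha⟩)
    | (obtain ⟨α, ha, hb⟩ := p02; exact ⟨α, hb, ha⟩)
    | (obtain ⟨α, ha, hb⟩ := p12; exact ⟨α, hb, ha⟩)

/-- **crux ⇒ gate form** (unconditional): triples with gate data are stably trivial.
[folklore] -/
theorem isStablyTrivial_of_inGate (h : NormalFormStablyTrivial) (m : ℕ)
    (K : TrisectionKernels (3 + 3 * m)) (hg : InGate m K) : K.IsStablyTrivial := by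
  rw [normalFormStablyTrivial_iff_tripleForm] at h
  exact h m K hg.2.2.1 (pairsStandard_of_inGate hg)

/-- **Modulo `Iso`-invariance of stable triviality the crux IS its gate form.**  (`←`: pull `K`
back along the automorphism `α₀₁` standardising the pair `(K₀, K₁)`; the pulled-back triple has
gate data, hence is stably trivial; push forward.)  The hypothesis `hI` is true on paper (Nielsen
1927: every automorphism of `S_g` lifts to `F_{2g}` fixing the relator up to conjugacy and
inversion; then `iso_stabilize_map_of_lift`) but is in tree only for liftable automorphisms — so
"WLOG `(K₀,K₁) = (N₀,N₁)`" costs exactly Nielsen. [cite: Nielsen1927] -/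
theorem normalFormStablyTrivial_iff_gate
    (hI : ∀ (g : ℕ) (K K' : TrisectionKernels g), K.Iso K' → K.IsStablyTrivial → K'.IsStablyTrivial) :
    NormalFormStablyTrivial ↔
      ∀ (m : ℕ) (K : TrisectionKernels (3 + 3 * m)), InGate m K → K.IsStablyTrivial := by
  refine ⟨isStablyTrivial_of_inGate, fun hG => ?_⟩
  rw [normalFormStablyTrivial_iff_tripleForm]
  intro m K hs hP
  obtain ⟨α, h0, h1⟩ := hP 0 1 (by decide)
  -- the pulled-back triple
  let K' : TrisectionKernels (3 + 3 * m) := fun i => (K i).map α.symm.toMonoidHom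
  have hcomp : α.toMonoidHom.comp α.symm.toMonoidHom = MonoidHom.id _ :=
    MonoidHom.ext fun x => α.apply_symm_apply x
  have hcomp' : α.symm.toMonoidHom.comp α.toMonoidHom = MonoidHom.id _ :=
    MonoidHom.ext fun x => α.symm_apply_apply x
  have hback : ∀ i, (K' i).map α.toMonoidHom = K i := fun i => by
    show ((K i).map α.symm.toMonoidHom).map α.toMonoidHom = K i
    rw [Subgroup.map_map, hcomp, Subgroup.map_id]
  have hK'0 : K' 0 = s4Kernels.stabilizeIter m 0 := by
    show (K 0).map α.symm.toMonoidHom = _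
    rw [← h0, Subgroup.map_map, hcomp', Subgroup.map_id]
  have hK'1 : K' 1 = s4Kernels.stabilizeIter m 1 := by
    show (K 1).map α.symm.toMonoidHom = _
    rw [← h1, Subgroup.map_map, hcomp', Subgroup.map_id]
  have hP' : PairsStandard m K' := by
    intro i j hij
    obtain ⟨δ, hi, hj⟩ := hP i j hij
    have ht : (δ.trans α.symm).toMonoidHom = α.symm.toMonoidHom.comp δ.toMonoidHom :=
      MonoidHom.ext fun _ => rfl
    refine ⟨δ.trans α.symm, ?_, ?_⟩
    · rw [ht, ← Subgroup.map_map, hi]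
    · rw [ht, ← Subgroup.map_map, hj]
  have hIso : TrisectionKernels.Iso K' K := ⟨α, hback⟩
  obtain ⟨e⟩ := Iso.nonempty_tripleQuotient_equiv hIso
  have hs' : Subsingleton K'.tripleQuotient := e.toEquiv.subsingleton
  obtain ⟨β, hb0, hb2⟩ := hP' 0 2 (by decide)
  obtain ⟨γ, hc1, hc2⟩ := hP' 1 2 (by decide)
  have hst' : K'.IsStablyTrivial :=
    hG m K' ⟨hK'0, hK'1, hs', ⟨β, hb0.trans hK'0, hb2⟩, ⟨γ, hc1.trans hK'1, hc2⟩⟩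
  exact hI _ K' K hIso hst'


/-- **Nielsen ⇒ `Iso`-invariance of stable triviality.**  Granted the tree's Nielsen hypothesis
`hN` (every automorphism of every `S_G` lifts to the free group sending the relator to a conjugate
of `r^{±1}`; the hypothesis of `TrisectionKernels.Iso.stabilizeIter_of_liftable`,
TrisectionFunctorSPC4Proofs.lean — Nielsen 1927 + Magnus, true on paper, not proved in tree),
isomorphic kernel triples are stably trivial together. [cite: Nielsen1927] -/
theorem isoInvariant_of_nielsen
    (hN : ∀ (G : ℕ) (α : SurfaceGroup G ≃* SurfaceGroup G),
      ∃ (φ : FreeGroup (surfaceGen G) ≃* FreeGroup (surfaceGen G)) (c : FreeGroup (surfaceGen G))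
        (ε : ℤ), (ε = 1 ∨ ε = -1) ∧ φ (surfaceRelator G) = c * surfaceRelator G ^ ε * c⁻¹ ∧
        ∀ x, PresentedGroup.mk _ (φ x) = α (PresentedGroup.mk _ x))
    (g : ℕ) (K K' : TrisectionKernels g) (h : K.Iso K') (hK : K.IsStablyTrivial) :
    K'.IsStablyTrivial := by
  obtain ⟨n, m, e, hiso⟩ := hK
  exact ⟨n, m, e, (TrisectionKernels.Iso.stabilizeIter_of_liftable hN h n).symm.trans hiso⟩

/-- **Modulo Nielsen (the tree's registered gap `hN`) the crux IS its gate form.** [cite: Nielsen1927] -/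
theorem normalFormStablyTrivial_iff_gate_of_nielsen
    (hN : ∀ (G : ℕ) (α : SurfaceGroup G ≃* SurfaceGroup G),
      ∃ (φ : FreeGroup (surfaceGen G) ≃* FreeGroup (surfaceGen G)) (c : FreeGroup (surfaceGen G))
        (ε : ℤ), (ε = 1 ∨ ε = -1) ∧ φ (surfaceRelator G) = c * surfaceRelator G ^ ε * c⁻¹ ∧
        ∀ x, PresentedGroup.mk _ (φ x) = α (PresentedGroup.mk _ x)) :
    NormalFormStablyTrivial ↔
      ∀ (m : ℕ) (K : TrisectionKernels (3 + 3 * m)), InGate m K → K.IsStablyTrivial :=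
  normalFormStablyTrivial_iff_gate (isoInvariant_of_nielsen hN)


/-! ## §5 Level descent modulo Nielsen: the crux may be assumed only for large `m` -/

/-- `PairsStandard` ascends along one stabilisation, granted Nielsen: stabilise the pair
automorphism by `iso_stabilize_map_of_lift` (stabilisation is slot-wise). [folklore] -/
theorem pairsStandard_stabilize_of_nielsen
    (hN : ∀ (G : ℕ) (α : SurfaceGroup G ≃* SurfaceGroup G),
      ∃ (φ : FreeGroup (surfaceGen G) ≃* FreeGroup (surfaceGen G)) (c : FreeGroup (surfaceGen G))
        (ε : ℤ), (ε = 1 ∨ ε = -1) ∧ φ (surfaceRelator G) = c * surfaceRelator G ^ ε * c⁻¹ ∧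
        ∀ x, PresentedGroup.mk _ (φ x) = α (PresentedGroup.mk _ x))
    {K : TrisectionKernels (3 + 3 * m)} (h : PairsStandard m K) :
    PairsStandard (m + 1) K.stabilize := by
  intro i j hij
  obtain ⟨α, hi, hj⟩ := h i j hij
  obtain ⟨α', hα'⟩ :=
    TrisectionKernels.iso_stabilize_map_of_lift (s4Kernels.stabilizeIter m) α (hN _ α)
  refine ⟨α', ?_, ?_⟩
  · show ((s4Kernels.stabilizeIter m).stabilize i).map α'.toMonoidHom = K.stabilize i
    rw [hα' i]
    simp only [TrisectionKernels.stabilize_apply, hi]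
  · show ((s4Kernels.stabilizeIter m).stabilize j).map α'.toMonoidHom = K.stabilize j
    rw [hα' j]
    simp only [TrisectionKernels.stabilize_apply, hj]

/-- **LEVEL DESCENT modulo Nielsen.**  The crux at level `m + 1` implies the crux at level `m`
(stabilise once: the hypotheses ascend — `stabilize_isGroupTrisection_holds` and
`pairsStandard_stabilize_of_nielsen` — and stable triviality descends,
`isStablyTrivial_of_stabilizeIter`).  So, granted Nielsen, the crux is equivalent to its EVENTUAL
form "for all `m ≥ m₀`" for any `m₀` (e.g. the asymptotic regime `g ≫ 0` of Dunfield–Thurston used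
by the route's rung `ShadowsStandard`), and no refutation can come from small `m` alone unless it
persists stably. [folklore] -/
theorem level_down_of_nielsen
    (hN : ∀ (G : ℕ) (α : SurfaceGroup G ≃* SurfaceGroup G),
      ∃ (φ : FreeGroup (surfaceGen G) ≃* FreeGroup (surfaceGen G)) (c : FreeGroup (surfaceGen G))
        (ε : ℤ), (ε = 1 ∨ ε = -1) ∧ φ (surfaceRelator G) = c * surfaceRelator G ^ ε * c⁻¹ ∧
        ∀ x, PresentedGroup.mk _ (φ x) = α (PresentedGroup.mk _ x))
    (h : ∀ K : TrisectionKernels (3 + 3 * (m + 1)),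
      IsGroupTrisection (3 + 3 * (m + 1)) (m + 1 + 1) (PUnit : Type) K →
        PairsStandard (m + 1) K → K.IsStablyTrivial)
    (K : TrisectionKernels (3 + 3 * m)) (hK : IsGroupTrisection (3 + 3 * m) (m + 1) (PUnit : Type) K)
    (hP : PairsStandard m K) : K.IsStablyTrivial :=
  isStablyTrivial_of_stabilizeIter K 1
    (h K.stabilize (stabilize_isGroupTrisection_holds _ _ _ _ hK)
      (pairsStandard_stabilize_of_nielsen hN hP))

end Summit.SmoothPoincare4.SmoothPoincare4.Theorems.NormalFormStablyTrivial.Negative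

end
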